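import Summits.CriticalPhenomena.Ising3DConformalLimit.Theorems.EnergyNotSigmaSquaredGapForcesFarMergingScreeningUnpinGlue
import Summits.CriticalPhenomena.Ising3DConformalLimit.Theorems.EnergyNotSigmaSquaredGapForcesFarMergingRootOpacityDoubling

/-!
# The reshaped far end of line `screening-form-lemma-a1`: flexible-aspect glue and the two certificates
(crux `GapForcesFarMerging`, item stmt-CriticalPhenomena-4468, route `EnergyNotSigmaSquared`; lead seat c2
`prover-line-stmt-CriticalPhenomena-4468-c2-0`; helper file of the registered stub
`stub_farScreening : HittingLowerBound → RootOpacityIO → FarScreeningIO`)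

* `farScreening_of_unpinFlex : HazardRelocationFlex → UnpinFlex → RootOpacityIO → FarScreeningIO` (registered) — the glue of
  `…ScreeningUnpinGlue.lean` with the bounded aspect `2^A` chosen by the relocation (currencies of the Defs part 2 append):
  (pigeonhole lemma `frequently_exists_mem_finset` of `…ScreeningUnpinGlue.lean`, p121744); `RootOpacityIO` gives infinitely many
  windowed opaque octaves `k` (far scale `m ≥ 2^{k+3}`, frequently in `n`),
  `HazardRelocationFlex` moves the far ends to `2^{k+A}`, `UnpinFlex` at that `A` screens a fresh probe from `2^{k-j}u`, and a
  pigeonhole over the finite family pins one shape `unpinShape 2^{j+A} u` along `L = 2^{k-j}`;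
* `gapForcesFarMerging_of_floors_hazardRelocationFlex_unpinFlex` — `Floors → HazardRelocationFlex → UnpinFlex → crux` (p100284 + glue);
* `gapForcesFarMerging_of_doubling_bulkFloor` — `TwoPointDoubling → BulkFloor → HazardRelocationFlex → UnpinFlex → crux`, where
  `BulkFloor` is the second conjunct of `Floors` and the octave floors are replaced by the open item stmt-CriticalPhenomena-6150
  (`rootOpacity_of_doubling_bulkFloor`, landed p122330).
Pure composition; no lattice input.
-/

noncomputable section

namespace Summit.CriticalPhenomena.Ising3DConformalLimit.GapForcesFarMergingScreening

open scoped symmDiff ENNReal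
open MeasureTheory Filter Finset
open Literature.Probability.LatticeModels Literature.Probability.Percolation
open Summit.CriticalPhenomena.Ising3DConformalLimit.Theorems.GapForcesFarMerging.Negative
  (e₁ e₂ cc2 xR up dn FarMergingShape SinglePinchLawShape crux_iff_shapes)
open Summit.CriticalPhenomena.Ising3DConformalLimit.EnergyNotSigmaSquaredGapForcesFarMerging
  (gapForcesFarMerging_of_floors_farScreening rootOpacity_of_doubling_bulkFloor stub_screeningDecay
    stub_screeningIdentity stub_farMerging singlePinchLawShape_of_gap)

/-- **THE RESHAPED FAR END, flexible aspect (registered glue)**: hazard relocation to an aspect `2^A` chosen by the drop,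
plus un-pinning at that aspect, turn root opacity into far screening of a fixed dilated shape. [folklore] -/
theorem farScreening_of_unpinFlex : HazardRelocationFlex → UnpinFlex → RootOpacityIO → FarScreeningIO := by
  intro hH hU hRO
  obtain ⟨c, θ, hc, hθ, hfreq⟩ := hRO
  obtain ⟨A, _, c', hc', hH'⟩ := hH c hc
  obtain ⟨c'', hc'', j, F, hinj, hU'⟩ := hU A c' θ hc' hθ
  -- at every opaque windowed octave some `u ∈ F` is screened, frequently in `n`
  have hk : ∃ᶠ k : ℕ in atTop, ∃ u ∈ F, ∃ᶠ n : ℕ in atTop,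
      meanScreening n n 0 (up (2 ^ (k + A))) ((((2 ^ (k - j) : ℕ) : ℤ)) • u) (dn (2 ^ (k + A))) ≤ 1 - c'' := by
    refine (hfreq.and_eventually (hH'.and hU')).mono ?_
    rintro k ⟨⟨hwin, m, hm, hfrn⟩, hHk, hUk⟩
    refine frequently_exists_mem_finset ?_
    refine (hfrn.and_eventually ((hHk m hm).and (hUk hwin))).mono ?_
    rintro n ⟨hop, hHn, hUn⟩
    exact hUn (hHn hop)
  -- pigeonhole over the finite family: one `u` serves infinitely many octaves
  obtain ⟨u, huF, hku⟩ := frequently_exists_mem_finset hk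
  refine ⟨c'', hc'', unpinShape (2 ^ (j + A)) u, hinj u huF, fun L₀ => ?_⟩
  obtain ⟨k, hk0, hkn⟩ := (Filter.frequently_atTop.1 hku) (j + L₀)
  refine ⟨2 ^ (k - j), ?_, ?_⟩
  · calc L₀ ≤ k - j := by omega
      _ ≤ 2 ^ (k - j) := Nat.lt_two_pow_self.le
  · obtain ⟨h0, h1, h2, h3⟩ := zsmul_unpinShape (2 ^ (j + A)) (2 ^ (k - j)) u
    have hpow : 2 ^ (j + A) * 2 ^ (k - j) = 2 ^ (k + A) := by
      rw [← pow_add]; congr 1; omega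
    rw [h0, h1, h2, h3, hpow]
    exact hkn

/-- **The crux modulo the three open stubs of the reshaped line, flexible aspect** (`Floors`, `HazardRelocationFlex`,
`UnpinFlex`): the landed certificate `gapForcesFarMerging_of_floors_farScreening` (p100284) with the far end supplied by
`farScreening_of_unpinFlex`. [folklore] -/
theorem gapForcesFarMerging_of_floors_hazardRelocationFlex_unpinFlex :
    Floors → HazardRelocationFlex → UnpinFlex →
      Summit.CriticalPhenomena.Ising3DConformalLimit.Theses.EnergyNotSigmaSquared.GapForcesFarMerging :=
  fun hF hH hU => gapForcesFarMerging_of_floors_farScreening hF (farScreening_of_unpinFlex hH hU)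

/-- **The crux modulo two-point doubling, the BULK floor and the two reshaped stubs**: under `TwoPointDoubling`
(item stmt-CriticalPhenomena-6150, a hypothesis) the octave floors are not needed (`rootOpacity_of_doubling_bulkFloor`,
p122330); GAP enters through `singlePinchLawShape_of_gap` and `stub_screeningDecay`, the far end through `stub_farMerging`. [folklore] -/
theorem gapForcesFarMerging_of_doubling_bulkFloor :
    Summit.CriticalPhenomena.Ising3DConformalLimit.Theses.MirrorHoelderCompactness.TwoPointDoubling →
      (∃ δ : ℝ, 0 < δ ∧ ∀ᶠ k : ℕ in atTop, ∀ m : ℕ, 2 ^ (k + 3) ≤ m → m < 2 ^ (k + 4) →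
        ∀ᶠ n : ℕ in atTop, δ * pinchScreen n (2 ^ k) m ≤ pinchScreen n n m) →
      HazardRelocationFlex → UnpinFlex →
        Summit.CriticalPhenomena.Ising3DConformalLimit.Theses.EnergyNotSigmaSquared.GapForcesFarMerging := by
  intro hTD hBulk hH hU
  rw [crux_iff_shapes]
  intro hGap
  exact stub_farMerging stub_screeningIdentity
    (farScreening_of_unpinFlex hH hU
      (rootOpacity_of_doubling_bulkFloor hTD (stub_screeningDecay stub_screeningIdentity (singlePinchLawShape_of_gap hGap))
        hBulk))

end Summit.CriticalPhenomena.Ising3DConformalLimit.GapForcesFarMergingScreening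

end
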